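import Summits.NavierStokesRegularity.NavierStokesRegularity.Theses.AxisymmetricExtremality
import Literature.Analysis.FluidPDE.NSKatoToClayHolds
import Literature.Analysis.FluidPDE.MildSolutionsProofs
import Literature.Analysis.FunctionSpaces.FourierSobolevNormProofs
import Literature.Analysis.FunctionSpaces.FourierSobolevNormEmbeddingProofs
import Literature.Analysis.FluidPDE.CriticalSpaces
import Literature.Analysis.FluidPDE.VectorCalculus
import Mathlib.Analysis.Distribution.Sobolev
import HarnessLib

/-!
# Route AxisymmetricExtremality — support item `ClayDatumCritical` PROVED
  (stmt-NavierStokesRegularity-15306)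

**A Clay datum is a critical datum**: a smooth, divergence-free, rapidly decaying
`u₀ : ℝ³ → ℝ³` lies in `L³`, is weakly divergence free, and is represented by some
`g ∈ Ḣ^{1/2}(ℝ³; ℂ³)`. Proof (steps (b)–(d) of the landed front end
`stub_thresholdFinite_of_clayFailure` of crux `MinimalDatumPFold`, isolated): the complexified
datum is a Schwartz map, hence in `Ḣ^{1/2} ∩ L²` (Mathlib's `SchwartzMap.memSobolev` + the tree's
bridges `memSobolev_two_iff_eFourierSobolevNorm_lt_top_holds`, `MemFourierSobolev.memHomSobolev_holds`;
Bahouri–Chemin–Danchin 2011, §1.4.1), so `u₀ ∈ L³` by the Sobolev embedding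
`memLp_three_of_memHomSobolev_half`, it is weakly divergence free
(`VectorCalculus.IsDivFree.isWeaklyDivFree_holds`), and `HomSobolev.ofFun` represents it
(`HomSobolev.represents_ofFun_holds`).

HONEST FRAMING: bookkeeping over PROVED tree facts; nothing here bears on the regularity question.
Lands `--workitem stmt-NavierStokesRegularity-15306` (typer seat g19 of cell pub-ns-dss, idle-row
item).
-/

set_option linter.dupNamespace false

noncomputable section

open MeasureTheory Set Function Filter Topology
open Literature.Analysis.FluidPDE Literature.Analysis.FunctionSpaces
open Literature.Analysis.FunctionSpaces.EuclideanSpace (complexify contDiff_complexify_comp_iff)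
open scoped ENNReal NNReal SchwartzMap

namespace Summit.NavierStokesRegularity.NavierStokesRegularity.Theorems

/-- Schwartz maps lie in `Ḣ^s ∩ L²` for `s ≥ 0` (Mathlib `SchwartzMap.memSobolev`, the tree's
bridge `memSobolev_two_iff_eFourierSobolevNorm_lt_top_holds` and `H^s ⊆ Ḣ^s ∩ L²`,
`MemFourierSobolev.memHomSobolev_holds`; Bahouri–Chemin–Danchin 2011, §1.4.1). (Same argument as the
private lemma of `AxisymmetricExtremalityMinimalDatumPFoldThresholdFinite`.) [cite: BahouriCheminDanchin2011, §1.4.1 (H^s ⊆ Ḣ^s ∩ L² for s ≥ 0)] -/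
theorem clayDatumCritical_memHomSobolev_schwartz {E F : Type*} [NormedAddCommGroup E]
    [InnerProductSpace ℝ E] [FiniteDimensional ℝ E] [MeasurableSpace E] [BorelSpace E]
    [NormedAddCommGroup F] [InnerProductSpace ℂ F] [CompleteSpace F] {s : ℝ} (hs : 0 ≤ s)
    (f : 𝓢(E, F)) : MemHomSobolev s (⇑f) := by
  have hB : TemperedDistribution.MemSobolev s 2
      ((f.toLp 2 (volume : Measure E) : Lp F 2 (volume : Measure E)) : 𝓢'(E, F)) := by
    rw [Lp.toTemperedDistribution_toLp_eq]
    exact f.memSobolev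
  have h := memSobolev_two_iff_eFourierSobolevNorm_lt_top_holds (E := E) (F := F)
  exact MemFourierSobolev.memHomSobolev_holds hs ⟨f.memLp 2 volume, (h s _).1 hB⟩

/-- **`ClayDatumCritical` (stmt-NavierStokesRegularity-15306).** A smooth, divergence-free, rapidly
decaying datum on `ℝ³` is in `L³`, weakly divergence free, and represented by a class in
`Ḣ^{1/2}(ℝ³; ℂ³)`. [this file] -/
theorem axisymmetricExtremality_clayDatumCritical_proof :
    Theses.AxisymmetricExtremality.ClayDatumCritical := by
  intro u₀ hsm hdiv hdec
  -- the complexified datum is a Schwartz map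
  have hdecay : ∀ k n : ℕ, ∃ C : ℝ, ∀ x : EuclideanSpace ℝ (Fin 3),
      ‖x‖ ^ k * ‖iteratedFDeriv ℝ n (complexify ∘ u₀) x‖ ≤ C := by
    intro k n
    obtain ⟨C, hC⟩ := hdec n k
    refine ⟨C, fun x => le_trans ?_ (hC x)⟩
    rw [(complexify (ι := Fin 3)).norm_iteratedFDeriv_comp_left hsm.contDiffAt
      (mod_cast le_top)]
    exact mul_le_mul_of_nonneg_right
      (pow_le_pow_left₀ (norm_nonneg _) (le_add_of_nonneg_left zero_le_one) k) (norm_nonneg _)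
  have hmem : MemHomSobolev (1 / 2 : ℝ) (complexify ∘ u₀) :=
    clayDatumCritical_memHomSobolev_schwartz (by norm_num)
      ⟨complexify ∘ u₀, contDiff_complexify_comp_iff.2 hsm, hdecay⟩
  have hu3 : MemLp u₀ 3 volume :=
    memLp_three_of_memHomSobolev_half eLpNorm_three_le_eHomSobolevSeminorm_half_holds hmem
  have hdiv' : VectorCalculus.IsDivFree u₀ := fun x => hdiv x
  have hwdiv : IsWeaklyDivFree u₀ :=
    VectorCalculus.IsDivFree.isWeaklyDivFree_holds hdiv' (hsm.of_le (mod_cast le_top))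
  have hE : 0 < Module.finrank ℝ (EuclideanSpace ℝ (Fin 3)) := by
    rw [finrank_euclideanSpace_fin]
    norm_num
  exact ⟨hu3, hwdiv, HomSobolev.ofFun (complexify ∘ u₀) hmem,
    HomSobolev.represents_ofFun_holds hE (complexify ∘ u₀) hmem⟩

end Summit.NavierStokesRegularity.NavierStokesRegularity.Theorems

end
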